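import Literature.MathematicalPhysics.QuantumFieldTheory.Balaban1983to89.Setup
import HarnessLib

/-!
# S2β · D-GUARD ∕ (BG∞) — THE PARITY BLOCK PARTITION OF `ZMod N` EXISTS (gap-list item (G6) of UV3-NODE §116.4, def-free edition): for `1 ≤ ρ`, `8ρ ≤ N` there are an
# EVEN number `M ≥ 8` of consecutive blocks of lengths in `[ρ, (4ρ+3)∕3]` tiling the cycle, with an owner map `ZMod N → Fin M` locating every residue in its block

Cell `ym3-torus` (YM ladder rung R3 = continuum `SU(2)` Yang–Mills on the three-torus at fixed lattice data — a RUNG: NOT d = 4, NOT infinite volume,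
NOT a mass gap, NOT Clay).  Width seat «width 19» `ym3-torus-px19` (gen 25, ★p1 lineage), FREE px helper on crux `stmt-QuantumFields-20520`
(`FluctuationComparisonRegPrIntL`; registry `Lines/semiclassical_s2beta.lean` UNTOUCHED, 0∕5); `--kind proof --supports stmt-QuantumFields-20520 --as helper`,
count-neutral, DEFINITION-FREE (0 `def`, 0 `instance`, 0 `notation`, 0 `sorry`, default heartbeats).  (BG∞) plan of record: UV3-NODE §116 (architect ruling px17 g23
2026-09-01T00:13:02Z, desk RULING №123); this is (G6) in DISPLAYED form (no `structure`): applied per axis it inhabits the HOME sketch's `ParityBlocks P ρ` and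
discharges its `stub_parityBlocks`; a later reviewed `…SqrtGaugeDefs.lean` (D-0016) may package the same witnesses — this file is neutral to that decision.

WHY.  The 8-colour gluing of §116.3 (Case L, `N ≥ 8ρ`) cuts each axis of the torus `(ZMod N)³` into an EVEN number of consecutive blocks (so that the parity colouring
is consistent around the cycle and two distinct closed blocks of one colour never meet) of side `≥ ρ` (so each block is a unit cube at scale `θ^{−1∕2}`) and
`≤ (4ρ+3)∕3` (so the corner axial gauge of ✓`…ClosedBlockAxialGauge` pays `≤ (4ρ+6)θ` and the comb fan does not wrap), and every site needs an owner block
whose closed block contains it and the bond leaving it.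

THE WITNESSES (all inside the proof; nothing is defined): `q := N ∕ 2ρ ≥ 4`, `M := 2q`, `c := N ∕ M`, `r := N % M` (`N = M·c + r`, `r < M`, `ρ ≤ c`, `3c ≤ 4ρ`);
`len i := c + [i < r]`; `start i := i·c + min i r`; `owner v :=` the block of `n := v.val`: `n ∕ (c+1)` if `n < r(c+1)`, else `r + (n − r(c+1)) ∕ c`.

WHAT IS PROVED (sorry-free).
* §1 arithmetic of the witnesses: `four_le_div_two_mul`, `rho_le_div`, `three_mul_div_le`, `start_succ_aux`, `owner_lt_of_lt`, `owner_lt_of_ge`, `owner_law_of_lt`,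
  `owner_law_of_ge`.
* §2 ★★★ `exists_parityBlocks (N ρ) [NeZero N] (hρ : 1 ≤ ρ) (hN : 8ρ ≤ N) : ∃ M len start owner, Even M ∧ 8 ≤ M ∧ (∀ i, ρ ≤ len i ∧ 3·len i ≤ 4ρ + 3) ∧
  (∀ i, i.val = 0 → start i = 0) ∧ (∀ i j, j.val = i.val + 1 → start j = start i + len i) ∧ (∀ i, i.val + 1 = M → start i + len i = N) ∧
  (∀ v : ZMod N, start (owner v) ≤ v.val ∧ v.val < start (owner v) + len (owner v))`.
* §3 ★ `val_sub_natCast_le_of` — the `ZMod` reading used by the sketch's `closed` blocks: `s ≤ v.val → v.val ≤ s + ℓ → (v − (s : ZMod N)).val ≤ ℓ`;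
  ★ `val_add_one_sub_natCast_le_of` — and for the bond's target `v + 1`, wrap of the last block included: `s ≤ v.val → v.val < s + ℓ → ℓ < N →
  (v + 1 − (s : ZMod N)).val ≤ ℓ` (the form the sketch's `tgt_mem` needs).

HONEST SCOPE.  Elementary `Nat`∕`ZMod` arithmetic; no gauge field, no group; nothing of Bałaban's renormalisation-group analysis is asserted or proved ([Balaban1985RegularSpaces]
Lemma 1 p.79 cuts CUBES of side `O(L)` — the analogous partition in print, local; the torus-global parity tiling is the (BG∞) plan's, NOT in print).  (BG∞) ∕ `hsupp⁺` is
a CONJECTURE (LEAD §114.3, plan §116, FL-39 alive) and is NOT proved; (G7)-lattice, (G8) filing, Case S are OPEN; GAP♯∘ (`stub_uniformFibreGapOrbit`, registry UNTOUCHED),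
the five registered stubs (0∕5), S2β, 20520, 19936, 19200, `YM3TorusSU2` are NOT proved; no registered stub is closed; rung R3 — NOT d = 4, NOT infinite volume, NOT a
mass gap, NOT Clay; the Yang–Mills mass gap is NOT proved.  Axioms standard.

References: T. Bałaban, CMP **99** (1985) 75–102 [Balaban1985RegularSpaces] (Lemma 1 p.79, (1.29) p.81).
-/

set_option autoImplicit false

namespace Summit.QuantumFields.YangMills.Theorems.FluctuationComparisonRegPrIntLS2BetaParityBlockPartition

/-! ## §1 Arithmetic of the witnesses -/

/-- `8ρ ≤ N`, `1 ≤ ρ` ⟹ `4 ≤ N ∕ 2ρ`. [folklore] -/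
theorem four_le_div_two_mul {N ρ : ℕ} (hρ : 1 ≤ ρ) (hN : 8 * ρ ≤ N) : 4 ≤ N / (2 * ρ) :=
  (Nat.le_div_iff_mul_le (by omega)).2 (by linarith)

/-- With `q := N ∕ 2ρ`: `ρ ≤ N ∕ 2q`. [folklore] -/
theorem rho_le_div {N ρ : ℕ} (hρ : 1 ≤ ρ) (hN : 8 * ρ ≤ N) : ρ ≤ N / (2 * (N / (2 * ρ))) := by
  have hq : 4 ≤ N / (2 * ρ) := four_le_div_two_mul hρ hN
  rw [Nat.le_div_iff_mul_le (by omega)]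
  have h := Nat.div_mul_le_self N (2 * ρ)
  calc ρ * (2 * (N / (2 * ρ))) = N / (2 * ρ) * (2 * ρ) := by ring
    _ ≤ N := h

/-- With `q := N ∕ 2ρ ≥ 4`: `3·(N ∕ 2q) ≤ 4ρ` (from `N < 2ρ(q+1)`, i.e. `q·c < ρ(q+1)`, and `3ρ ≤ qρ`). [folklore] -/
theorem three_mul_div_le {N ρ : ℕ} (hρ : 1 ≤ ρ) (hN : 8 * ρ ≤ N) : 3 * (N / (2 * (N / (2 * ρ)))) ≤ 4 * ρ := by
  set q := N / (2 * ρ) with hqdef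
  have hq : 4 ≤ q := four_le_div_two_mul hρ hN
  set c := N / (2 * q) with hcdef
  -- `2q·c ≤ N < 2ρ(q+1)`
  have h1 : c * (2 * q) ≤ N := Nat.div_mul_le_self N (2 * q)
  have h2 : N < q * (2 * ρ) + 2 * ρ := Nat.lt_div_mul_add (by omega)
  -- hence `q·c < ρ·(q+1)`, so `q·c ≤ ρ q + ρ − 1` and `3 q c ≤ 3ρq + 3ρ − 3 ≤ 4 ρ q`
  have h3 : q * c < ρ * q + ρ := by nlinarith
  have h4 : 3 * (q * c) < 4 * ρ * q + 1 := by nlinarith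
  have hqpos : 0 < q := by omega
  by_contra hcon
  rw [not_le] at hcon
  -- `4ρ + 1 ≤ 3c` ⟹ `q(4ρ+1) ≤ 3qc`
  have h5 : q * (4 * ρ + 1) ≤ q * (3 * c) := Nat.mul_le_mul_left q hcon
  nlinarith

/-- `min (i+1) r = min i r + [i < r]` — the successor law of `start i := i·c + min i r`. [folklore] -/
theorem start_succ_aux (i r c : ℕ) :
    (i + 1) * c + min (i + 1) r = (i * c + min i r) + (if i < r then c + 1 else c) := by
  rw [add_mul, one_mul]
  split_ifs with h
  · rw [min_eq_left (by omega : i + 1 ≤ r), min_eq_left h.le]; ring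
  · rw [not_lt] at h
    rw [min_eq_right (by omega : r ≤ i + 1), min_eq_right h]; ring

/-- Owner bound, first regime: `n < r(c+1)` ⟹ `n ∕ (c+1) < M` (given `r < M`). [folklore] -/
theorem owner_lt_of_lt {n r c M : ℕ} (hn : n < r * (c + 1)) (hrM : r < M) : n / (c + 1) < M :=
  lt_trans ((Nat.div_lt_iff_lt_mul (by omega)).2 hn) hrM

/-- Owner bound, second regime: `r(c+1) ≤ n < M c + r`, `0 < c` ⟹ `r + (n − r(c+1)) ∕ c < M`. [folklore] -/
theorem owner_lt_of_ge {n r c M : ℕ} (hc : 0 < c) (hrM : r < M) (hnN : n < M * c + r) (hn : ¬ n < r * (c + 1)) :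
    r + (n - r * (c + 1)) / c < M := by
  rw [not_lt] at hn
  have h1 : n - r * (c + 1) < (M - r) * c := by
    have : M * c + r = r * (c + 1) + (M - r) * c := by
      zify [hrM.le]
      ring
    omega
  have h2 : (n - r * (c + 1)) / c < M - r := (Nat.div_lt_iff_lt_mul hc).2 h1
  omega

/-- Owner law, first regime: with `i := n ∕ (c+1) < r`, `start i = i(c+1) ≤ n < start i + (c+1)`. [folklore] -/
theorem owner_law_of_lt {n r c : ℕ} (hn : n < r * (c + 1)) :
    n / (c + 1) * c + min (n / (c + 1)) r ≤ n ∧ n < n / (c + 1) * c + min (n / (c + 1)) r + (if n / (c + 1) < r then c + 1 else c) := by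
  have hi : n / (c + 1) < r := (Nat.div_lt_iff_lt_mul (by omega)).2 hn
  rw [min_eq_left hi.le, if_pos hi]
  have h1 : n / (c + 1) * (c + 1) ≤ n := Nat.div_mul_le_self n (c + 1)
  have h2 : n < n / (c + 1) * (c + 1) + (c + 1) := Nat.lt_div_mul_add (by omega)
  constructor
  · calc n / (c + 1) * c + n / (c + 1) = n / (c + 1) * (c + 1) := by ring
      _ ≤ n := h1
  · calc n < n / (c + 1) * (c + 1) + (c + 1) := h2
      _ = n / (c + 1) * c + n / (c + 1) + (c + 1) := by ring

/-- Owner law, second regime: with `m := (n − r(c+1)) ∕ c`, `i := r + m ≥ r`, `start i = r(c+1) + m c ≤ n < start i + c`. [folklore] -/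
theorem owner_law_of_ge {n r c : ℕ} (hc : 0 < c) (hn : ¬ n < r * (c + 1)) :
    (r + (n - r * (c + 1)) / c) * c + min (r + (n - r * (c + 1)) / c) r ≤ n ∧
      n < (r + (n - r * (c + 1)) / c) * c + min (r + (n - r * (c + 1)) / c) r +
        (if r + (n - r * (c + 1)) / c < r then c + 1 else c) := by
  rw [not_lt] at hn
  set m := (n - r * (c + 1)) / c with hm
  have hi : ¬ r + m < r := not_lt.2 (Nat.le_add_right r m)
  rw [min_eq_right (Nat.le_add_right r m), if_neg hi]
  have h1 : m * c ≤ n - r * (c + 1) := Nat.div_mul_le_self _ c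
  have h2 : n - r * (c + 1) < m * c + c := Nat.lt_div_mul_add hc
  constructor
  · calc (r + m) * c + r = r * (c + 1) + m * c := by ring
      _ ≤ n := by omega
  · calc n < r * (c + 1) + (m * c + c) := by omega
      _ = (r + m) * c + r + c := by ring

/-! ## §2 The parity block partition -/

/-- ★★★ **THE PARITY BLOCK PARTITION OF `ZMod N` EXISTS** ((G6) of UV3-NODE §116.4, displayed form): for `1 ≤ ρ`, `8ρ ≤ N` there are an EVEN `M ≥ 8`, lengths
`len : Fin M → ℕ` in `[ρ, (4ρ+3)∕3]`, starts `start : Fin M → ℕ` consecutive (`start 0 = 0`, `start (i+1) = start i + len i`, `start (M−1) + len (M−1) = N`) and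
an owner map `owner : ZMod N → Fin M` with `start (owner v) ≤ v.val < start (owner v) + len (owner v)`. [cite: Balaban1985RegularSpaces, Lemma 1 p.79] -/
theorem exists_parityBlocks (N ρ : ℕ) [NeZero N] (hρ : 1 ≤ ρ) (hN : 8 * ρ ≤ N) :
    ∃ (M : ℕ) (len start : Fin M → ℕ) (owner : ZMod N → Fin M),
      Even M ∧ 8 ≤ M ∧ (∀ i, ρ ≤ len i ∧ 3 * len i ≤ 4 * ρ + 3) ∧
      (∀ i : Fin M, (i : ℕ) = 0 → start i = 0) ∧
      (∀ i j : Fin M, (j : ℕ) = (i : ℕ) + 1 → start j = start i + len i) ∧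
      (∀ i : Fin M, (i : ℕ) + 1 = M → start i + len i = N) ∧
      (∀ v : ZMod N, start (owner v) ≤ v.val ∧ v.val < start (owner v) + len (owner v)) := by
  -- the witnesses, as opaque naturals with their equations
  obtain ⟨q, hqdef⟩ : ∃ q, q = N / (2 * ρ) := ⟨_, rfl⟩
  have hq : 4 ≤ q := hqdef ▸ four_le_div_two_mul hρ hN
  obtain ⟨M, hMdef⟩ : ∃ M, M = 2 * q := ⟨_, rfl⟩
  have hM8 : 8 ≤ M := by omega
  have hMpos : 0 < M := by omega
  obtain ⟨c, hcdef⟩ : ∃ c, c = N / M := ⟨_, rfl⟩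
  obtain ⟨r, hrdef⟩ : ∃ r, r = N % M := ⟨_, rfl⟩
  have hdm : M * c + r = N := by rw [hcdef, hrdef]; exact Nat.div_add_mod N M
  have hrM : r < M := by rw [hrdef]; exact Nat.mod_lt N hMpos
  have hρc : ρ ≤ c := by rw [hcdef, hMdef, hqdef]; exact rho_le_div hρ hN
  have hc3 : 3 * c ≤ 4 * ρ := by rw [hcdef, hMdef, hqdef]; exact three_mul_div_le hρ hN
  have hcpos : 0 < c := by omega
  have hvN : ∀ v : ZMod N, v.val < M * c + r := fun v => by rw [hdm]; exact ZMod.val_lt v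
  refine ⟨M, fun i => if (i : ℕ) < r then c + 1 else c, fun i => (i : ℕ) * c + min (i : ℕ) r,
    fun v => if h : v.val < r * (c + 1) then ⟨v.val / (c + 1), owner_lt_of_lt h hrM⟩
      else ⟨r + (v.val - r * (c + 1)) / c, owner_lt_of_ge hcpos hrM (hvN v) h⟩,
    ⟨q, by omega⟩, hM8, fun i => ?_, fun i hi => ?_, fun i j hij => ?_, fun i hi => ?_, fun v => ?_⟩
  · -- lengths in `[ρ, (4ρ+3)∕3]`
    dsimp only
    split_ifs <;> constructor <;> omega
  · -- `start 0 = 0`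
    dsimp only
    simp [hi]
  · -- `start (i+1) = start i + len i`
    dsimp only
    rw [hij]
    exact start_succ_aux i r c
  · -- `start (M−1) + len (M−1) = N`
    dsimp only
    have hir : ¬ (i : ℕ) < r := by omega
    rw [if_neg hir, min_eq_right (by omega : r ≤ (i : ℕ))]
    calc (i : ℕ) * c + r + c = ((i : ℕ) + 1) * c + r := by ring
      _ = N := by rw [hi]; exact hdm
  · -- the owner law
    by_cases h : v.val < r * (c + 1)
    · simp only [h, dite_true]
      exact owner_law_of_lt h
    · simp only [h, dite_false]
      exact owner_law_of_ge hcpos h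

/-! ## §3 The `ZMod` reading used by closed blocks -/

/-- ★ If `s ≤ v.val ≤ s + ℓ` then `(v − s).val ≤ ℓ` in `ZMod N` (the sketch's `closed`-block membership from the owner law). [folklore] -/
theorem val_sub_natCast_le_of {N : ℕ} [NeZero N] (v : ZMod N) {s ℓ : ℕ} (hs : s ≤ v.val) (hv : v.val ≤ s + ℓ) :
    (v - (s : ZMod N)).val ≤ ℓ := by
  have hsN : s < N := lt_of_le_of_lt hs (ZMod.val_lt v)
  have hsv : ((s : ℕ) : ZMod N).val ≤ v.val := by rw [ZMod.val_natCast_of_lt hsN]; exact hs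
  rw [ZMod.val_sub hsv, ZMod.val_natCast_of_lt hsN]
  omega

/-- ★ And for the bond's TARGET one step up the same axis: if `s ≤ v.val < s + ℓ` and `ℓ < N` then `(v + 1 − s).val ≤ ℓ` — INCLUDING the wrap of the last block
(`v.val = N − 1`, `v + 1 = 0`, `s + ℓ = N`: the value is exactly `ℓ`). [folklore] -/
theorem val_add_one_sub_natCast_le_of {N : ℕ} [NeZero N] (v : ZMod N) {s ℓ : ℕ} (hs : s ≤ v.val) (hv : v.val < s + ℓ) (hℓ : ℓ < N) :
    (v + 1 - (s : ZMod N)).val ≤ ℓ := by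
  have h1 : v + 1 - (s : ZMod N) = ((v.val + 1 - s : ℕ) : ZMod N) := by
    rw [Nat.cast_sub (by omega : s ≤ v.val + 1)]
    push_cast
    rw [ZMod.natCast_zmod_val]
  rw [h1, ZMod.val_natCast_of_lt (by omega : v.val + 1 - s < N)]
  omega

end Summit.QuantumFields.YangMills.Theorems.FluctuationComparisonRegPrIntLS2BetaParityBlockPartition
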